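import Literature.Topology.FourManifolds.BandSumCommProofs
import Literature.Topology.FourManifolds.PlanarArch
import HarnessLib

/-!
# Lifting the edges of a band to the parameter circles of the summands

Topic `Literature/Topology/FourManifolds` (trunk T-4MAN). Toolkit for the decomposition of the
named fact `Literature.Topology.FourManifolds.Knot.Schubert1949_normalPosition` (tame normal form of band-sum
presentations, where knots are rebuilt from a presentation by explicit formulas). For band-sum
data `b : BandData K₁ K₂ K avoid` (`BandSum.lean`) the left edge line `y ↦ band (0, y)` of the
band runs along `K₁` and the right edge line `y ↦ band (1, y)` along `K₂`; this file lifts these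
edge curves to the parameter line of the respective knot and reads off the orientation clauses:

* `Literature.Topology.FourManifolds.Knot.contDiffAt_lift` — a continuous lift `φ` of a smooth arc on a knot `K` through
  `K ∘ circlePt` is `C^∞` (upgrade of `Knot.differentiableAt_lift`, `KnotArcLift.lean`);
* `Literature.Topology.FourManifolds.Knot.exists_lift_Icc` — lifts over an arbitrary parameter interval `[a, c]`, smooth
  inside, strictly monotone when the arc is injective;
* `Literature.Topology.FourManifolds.BandData.exists_leftLift` / `exists_rightLift` — for `-δ < y₀ < 1/2 < y₁ < 1 + δ`
  there is `Θ`, continuous on `[y₀, y₁]` and `C^∞` inside, with `K₁ (circlePt (Θ y)) = band (0, y)`;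
  it is **strictly increasing** with `Θ' > 0` (the clause `orient_left`: `K₁` traverses the left
  edge upwards) and its window is shorter than one period (`Θ y₁ < Θ y₀ + 1`); on the right edge
  the lift of `K₂` is strictly decreasing (`orient_right`);
* the edge curves themselves, `y ↦ band (a, y)`: smooth, injective and regular
  (`contMDiff_band_pt2`, `injOn_band_pt2`, `deriv_coe_band_pt2`, `deriv_coe_band_pt2_ne_zero` —
  the specialisations to `γ = pt2 a` of `BandData.contMDiff_band_comp`, `deriv_coe_band_comp`,
  `fderiv_coe_band_ne_zero` of `BandSumCommProofs.lean`, whose `band_pt2_zero_mem` /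
  `band_pt2_one_mem` put the edges on the knots);
* `deriv_nonpos_of_strictAntiOn` / `deriv_nonneg_of_strictMonoOn` — sign of the derivative at an
  interior point of a strictly monotone function (generalising the endpoint-free forms in
  `KnotArcLift.lean`).

Relation to `BandSumJunction.lean`: that file treats the *closed left* edge reparametrised by
`[0, 1]` (`BandData.leftEdge`, `contMDiff_leftEdge`, `injOn_leftEdge`, `deriv_coe_leftEdge`,
`strictMonoOn_lift_leftEdge`, `exists_lift_leftEdge`, `lift_leftEdge_one_lt`, the window bound
needing injectivity of the band on the closed collar). Here the edge `x₀ = a` is arbitrary, the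
lifts live over open sub-windows `[y₀, y₁] ⊆ (-δ, 1 + δ)` of the height itself, and the output is
the smoothness of the lift and the *sign of its derivative* (both edges), with no hypothesis on
the closed collar — the form consumed by the rebuild construction (`BandRebuildArches.lean`).

## References

Standard covering-space and one-variable calculus arguments; all statements are `[folklore]`
(R. E. Gompf, A. I. Stipsicz, *4-Manifolds and Kirby Calculus* (1999), §5.1 for band sums;
A. Hatcher, *Algebraic Topology* (2002), Prop. 1.30 for lifts).
-/

open scoped Manifold ContDiff Topology Real
open Function Set Metric

noncomputable section

namespace Literature.Topology.FourManifolds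

/-- Local notation: `𝔼 n` is the model Euclidean space `EuclideanSpace ℝ (Fin n)`. -/
local notation "𝔼 " n:arg => EuclideanSpace ℝ (Fin n)

/-- Local notation: `𝕊 n` is the unit sphere in `EuclideanSpace ℝ (Fin (n + 1))`. -/
local notation "𝕊 " n:arg => (Metric.sphere (0 : EuclideanSpace ℝ (Fin (n + 1))) 1)

/-! ### Smooth lifts of arcs on a knot -/

namespace Knot

variable (K : Knot)

/-- **Lifts are smooth.** If `γ : ℝ → 𝕊³` is smooth at `s₀`, `φ` is continuous at `s₀` and
`K (circlePt (φ s)) = γ s` near `s₀`, then `φ` is `C^∞` at `s₀` (locally `φ = ang ∘ K⁻¹ ∘ γ`, as in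
`Knot.differentiableAt_lift`). [folklore] -/
theorem contDiffAt_lift {γ : ℝ → 𝕊 3} {φ : ℝ → ℝ} {s₀ : ℝ}
    (hγ : ContMDiffAt 𝓘(ℝ, ℝ) (𝓡 3) ∞ γ s₀) (hφ : ContinuousAt φ s₀)
    (heq : ∀ᶠ s in 𝓝 s₀, K (circlePt (φ s)) = γ s) : ContDiffAt ℝ ∞ φ s₀ := by
  haveI : Nonempty (𝕊 1) := ⟨circlePt 0⟩
  obtain ⟨g, hg⟩ := K.injective.hasLeftInverse
  have hgs : ContMDiffOn (𝓡 3) (𝓡 1) ∞ g (range K) :=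
    contMDiffOn_leftInverse_of_isImmersion K.isSmoothEmbedding.isImmersion K.isEmbedding hg
  obtain ⟨ang, hang, hangeq⟩ := exists_local_section_circlePt (φ s₀)
  have hφeq : φ =ᶠ[𝓝 s₀] ang ∘ g ∘ γ := by
    have h1 : ∀ᶠ s in 𝓝 s₀, ang (circlePt (φ s)) = φ s := hφ.eventually hangeq
    filter_upwards [h1, heq] with s hs1 hs2
    simp only [comp_apply, ← hs2, hg (circlePt (φ s)), hs1]
  have hmem : γ ⁻¹' range K ∈ 𝓝 s₀ := by
    filter_upwards [heq] with s hs
    exact ⟨_, hs⟩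
  have h0 : γ s₀ ∈ range K := (mem_of_mem_nhds hmem : s₀ ∈ γ ⁻¹' range K)
  have hgγ : ContMDiffAt 𝓘(ℝ, ℝ) (𝓡 1) ∞ (g ∘ γ) s₀ :=
    ((hgs _ h0).comp s₀ hγ.contMDiffWithinAt (mapsTo_preimage γ (range K))).contMDiffAt hmem
  have hval : (g ∘ γ) s₀ = circlePt (φ s₀) := by
    have := heq.self_of_nhds
    simp only [comp_apply, ← this, hg (circlePt (φ s₀))]
  have hcomp : ContMDiffAt 𝓘(ℝ, ℝ) 𝓘(ℝ, ℝ) ∞ (ang ∘ (g ∘ γ)) s₀ :=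
    ContMDiffAt.comp s₀ (by rw [hval]; exact hang) hgγ
  exact (contMDiffAt_iff_contDiffAt.mp hcomp).congr_of_eventuallyEq hφeq

/-- **Lifting an arc over an interval `[a, c]`.** A continuous `γ : ℝ → 𝕊³` with values on `K`
over `[a, c]` (`a < c`) lifts over `[a, c]` through `K ∘ circlePt` to a function `φ` continuous on
`[a, c]`; `φ` is `C^∞` at every interior point where `γ` is smooth, and if `γ` is injective on
`(a, c)` then `φ` is strictly monotone or strictly antitone on `[a, c]`. [folklore] -/
theorem exists_lift_Icc {γ : ℝ → 𝕊 3} (hγ : Continuous γ) {a c : ℝ} (hac : a < c)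
    (hmem : ∀ s ∈ Icc a c, γ s ∈ range K) :
    ∃ φ : ℝ → ℝ, ContinuousOn φ (Icc a c) ∧ (∀ s ∈ Icc a c, K (circlePt (φ s)) = γ s) ∧
      (∀ s ∈ Ioo a c, ContMDiffAt 𝓘(ℝ, ℝ) (𝓡 3) ∞ γ s → ContDiffAt ℝ ∞ φ s) ∧
      (InjOn γ (Ioo a c) → StrictMonoOn φ (Icc a c) ∨ StrictAntiOn φ (Icc a c)) := by
  -- reparametrise to `[0, 1]`
  set l : ℝ → ℝ := fun u ↦ a + u * (c - a) with hl
  set li : ℝ → ℝ := fun s ↦ (s - a) / (c - a) with hli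
  have hca : 0 < c - a := sub_pos.2 hac
  have hlli : ∀ s, l (li s) = s := fun s ↦ by
    simp only [hl, hli]; field_simp; ring
  have hli_mem : ∀ s ∈ Icc a c, li s ∈ Icc (0 : ℝ) 1 := fun s hs ↦
    ⟨div_nonneg (by linarith [hs.1]) hca.le, (div_le_one hca).2 (by linarith [hs.2])⟩
  have hli_mem' : ∀ s ∈ Ioo a c, li s ∈ Ioo (0 : ℝ) 1 := fun s hs ↦
    ⟨div_pos (by linarith [hs.1]) hca, (div_lt_one hca).2 (by linarith [hs.2])⟩
  have hl_mem : ∀ u ∈ Icc (0 : ℝ) 1, l u ∈ Icc a c := fun u hu ↦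
    ⟨by simp only [hl]; nlinarith [hu.1], by simp only [hl]; nlinarith [hu.2]⟩
  have hl_mem' : ∀ u ∈ Ioo (0 : ℝ) 1, l u ∈ Ioo a c := fun u hu ↦
    ⟨by simp only [hl]; nlinarith [hu.1], by simp only [hl]; nlinarith [hu.2]⟩
  obtain ⟨ψ, hψc, hψ⟩ := K.exists_lift (hγ.comp (by fun_prop : Continuous l))
    (fun u hu ↦ hmem _ (hl_mem u hu))
  refine ⟨ψ ∘ li, ?_, fun s hs ↦ ?_, fun s hs hγs ↦ ?_, fun hinj ↦ ?_⟩
  · exact (hψc.comp (by fun_prop : Continuous li)).continuousOn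
  · have := hψ (li s) (hli_mem s hs)
    simp only [comp_apply, hlli] at this ⊢
    exact this
  · -- smoothness inside
    have hlic : ContDiff ℝ ∞ li := (contDiff_id.sub contDiff_const).div_const _
    have hmem₁ : ∀ᶠ u in 𝓝 (li s), u ∈ Ioo (0 : ℝ) 1 := isOpen_Ioo.mem_nhds (hli_mem' s hs)
    have hψs : ContDiffAt ℝ ∞ ψ (li s) := by
      refine K.contDiffAt_lift (γ := γ ∘ l) ?_ ?_ ?_
      · have : ContMDiffAt 𝓘(ℝ, ℝ) 𝓘(ℝ, ℝ) ∞ l (li s) :=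
          (contDiff_const.add (contDiff_id.mul contDiff_const)).contDiffAt.contMDiffAt
        exact ContMDiffAt.comp (li s) (by rw [hlli]; exact hγs) this
      · exact hψc.continuousAt
      · filter_upwards [hmem₁] with u hu
        exact hψ u (Ioo_subset_Icc_self hu)
    exact hψs.comp s hlic.contDiffAt
  · -- monotonicity from injectivity
    have hinj' : InjOn (γ ∘ l) (Ioo 0 1) := by
      intro u hu u' hu' h
      have h1 : l u = l u' := hinj (hl_mem' u hu) (hl_mem' u' hu') h
      simp only [hl, add_right_inj] at h1
      exact mul_right_cancel₀ hca.ne' h1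
    have hmono := K.strictMonoOn_or_strictAntiOn_lift zero_lt_one hψc.continuousOn
      (fun u hu ↦ hψ u (Ioo_subset_Icc_self hu)) hinj'
    have hli_mono : StrictMonoOn li (Icc a c) := fun s _ t _ hst ↦
      div_lt_div_of_pos_right (by linarith) hca
    rcases hmono with h | h
    · left
      have h' : StrictMonoOn ψ (Icc 0 1) := strictMonoOn_Icc_of_Ioo hψc.continuousOn h
      exact fun s hs t ht hst ↦ h' (hli_mem s hs) (hli_mem t ht) (hli_mono hs ht hst)
    · right
      have h' : StrictAntiOn ψ (Icc 0 1) := by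
        have := strictMonoOn_Icc_of_Ioo (φ := fun u ↦ -ψ u) hψc.neg.continuousOn h.neg
        intro u hu u' hu' huu'
        have := this hu hu' huu'
        simpa using this
      exact fun s hs t ht hst ↦ h' (hli_mem s hs) (hli_mem t ht) (hli_mono hs ht hst)

end Knot

/-! ### Derivatives at interior points of monotone functions -/

/-- A function strictly antitone on an open interval has nonpositive derivative inside.
[folklore] -/
theorem deriv_nonpos_of_strictAntiOn {φ : ℝ → ℝ} {a c s : ℝ} (h : StrictAntiOn φ (Ioo a c))
    (hs : s ∈ Ioo a c) : deriv φ s ≤ 0 := by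
  rw [← derivWithin_of_mem_nhds (Ioo_mem_nhds hs.1 hs.2)]
  exact h.antitoneOn.derivWithin_nonpos

/-- A function strictly monotone on an open interval has nonnegative derivative inside.
[folklore] -/
theorem deriv_nonneg_of_strictMonoOn {φ : ℝ → ℝ} {a c s : ℝ} (h : StrictMonoOn φ (Ioo a c))
    (hs : s ∈ Ioo a c) : 0 ≤ deriv φ s := by
  rw [← derivWithin_of_mem_nhds (Ioo_mem_nhds hs.1 hs.2)]
  exact h.monotoneOn.derivWithin_nonneg

/-! ### The edge curves of a band -/

/-- Membership of `pt2 a y` in the square neighbourhood. [folklore] -/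
theorem pt2_mem_squareNhd_iff {δ a y : ℝ} :
    pt2 a y ∈ squareNhd δ ↔ a ∈ Ioo (-δ) (1 + δ) ∧ y ∈ Ioo (-δ) (1 + δ) := by
  simp [mem_squareNhd_iff, Fin.forall_fin_two]

/-- The vertical line through `(a, 0)` in the plane, `y ↦ (a, y)`, has velocity `(0, 1)`
(`hasDerivAt_pt2` of `PlanarArch.lean` with `u` constant and `v = id`). [folklore] -/
theorem hasDerivAt_pt2_right (a y : ℝ) : HasDerivAt (fun t : ℝ ↦ pt2 a t) (pt2 0 1) y :=
  hasDerivAt_pt2 (hasDerivAt_const y a) (hasDerivAt_id y)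

/-- The vertical line `y ↦ (a, y)` is `C^∞`. [folklore] -/
theorem contDiff_pt2_right (a : ℝ) : ContDiff ℝ ∞ fun t : ℝ ↦ pt2 a t := by
  rw [contDiff_euclidean]
  intro i
  fin_cases i
  · exact contDiff_const
  · exact contDiff_id

namespace BandData

variable {K₁ K₂ K : Knot} {avoid : Set (𝕊 3)} (b : BandData K₁ K₂ K avoid)

/-- The edge curves `y ↦ band (a, y)` are smooth (`BandData.contMDiff_band_comp` of
`BandSumCommProofs.lean` at `γ = pt2 a`). [folklore] -/
theorem contMDiff_band_pt2 (a : ℝ) : ContMDiff 𝓘(ℝ, ℝ) (𝓡 3) ∞ fun y : ℝ ↦ b.band (pt2 a y) :=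
  b.contMDiff_band_comp (contDiff_pt2_right a)

/-- The edge curves are continuous. [folklore] -/
theorem continuous_band_pt2 (a : ℝ) : Continuous fun y : ℝ ↦ b.band (pt2 a y) :=
  (b.contMDiff_band_pt2 a).continuous

/-- The vertical lines of the band are injective on the parameter range of the square
neighbourhood. [folklore] -/
theorem injOn_band_pt2 {a : ℝ} (ha : a ∈ Ioo (-b.δ) (1 + b.δ)) :
    InjOn (fun y : ℝ ↦ b.band (pt2 a y)) (Ioo (-b.δ) (1 + b.δ)) := by
  intro y hy y' hy' h
  have := b.injOn (pt2_mem_squareNhd_iff.2 ⟨ha, hy⟩) (pt2_mem_squareNhd_iff.2 ⟨ha, hy'⟩) h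
  simpa [pt2_apply_one] using congrArg (fun x : 𝔼 2 ↦ x 1) this

/-- The velocity of the edge curve `y ↦ band (a, y) ∈ ℝ⁴` is `∂band/∂x₁ (a, y)`
(`BandData.deriv_coe_band_comp` of `BandSumCommProofs.lean` at `γ = pt2 a`). [folklore] -/
theorem deriv_coe_band_pt2 (a y : ℝ) :
    deriv (fun t : ℝ ↦ ((b.band (pt2 a t) : 𝕊 3) : 𝔼 4)) y =
      fderiv ℝ (fun x ↦ ((b.band x : 𝕊 3) : 𝔼 4)) (pt2 a y) (pt2 0 1) := by
  rw [b.deriv_coe_band_comp (contDiff_pt2_right a) y, (hasDerivAt_pt2_right a y).deriv]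

/-- The edge curves are regular inside the band: `∂band/∂x₁ ≠ 0`
(`BandData.fderiv_coe_band_ne_zero` of `BandSumCommProofs.lean`). [folklore] -/
theorem deriv_coe_band_pt2_ne_zero {a y : ℝ} (h : pt2 a y ∈ squareNhd b.δ) :
    deriv (fun t : ℝ ↦ ((b.band (pt2 a t) : 𝕊 3) : 𝔼 4)) y ≠ 0 := by
  rw [deriv_coe_band_pt2]
  refine b.fderiv_coe_band_ne_zero h fun h0 ↦ ?_
  have : (1 : ℝ) = 0 := by simpa [pt2_apply_one] using congrArg (fun x : 𝔼 2 ↦ x 1) h0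
  exact one_ne_zero this

/-! ### Lifting the edges -/

/-- **Lifting an edge of the band, with its orientation.** Let `L` be a knot containing the
edge line `y ↦ band (a, y)` (`-δ < y < 1 + δ`) and suppose the orientation clause: at the
midpoint `band (a, 1/2)` the velocity of `θ ↦ L (cos θ, sin θ)` is `c ∂band/∂x₁`.
Then over any `[y₀, y₁] ∋ 1/2` inside `(-δ, 1 + δ)` the edge lifts to `Θ` (continuous, `C^∞`
inside, `L (circlePt (Θ y)) = band (a, y)`), and `Θ` is strictly increasing with positive
derivative and window shorter than one period if `c > 0`, strictly decreasing with negative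
derivative if `c < 0`: the velocity of the edge is `Θ' · 2πc · ∂band/∂x₁ ≠ 0`. [folklore] -/
theorem exists_edgeLift {L : Knot} {a c θ : ℝ} (ha : a ∈ Ioo (-b.δ) (1 + b.δ))
    (hmem : ∀ y ∈ Ioo (-b.δ) (1 + b.δ), b.band (pt2 a y) ∈ range L)
    (hpt : L (circlePoint θ) = b.band (pt2 a 2⁻¹))
    (hder : deriv (fun t ↦ ((L (circlePoint t) : 𝕊 3) : 𝔼 4)) θ =
      c • fderiv ℝ (fun x ↦ ((b.band x : 𝕊 3) : 𝔼 4)) (pt2 a 2⁻¹) (pt2 0 1))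
    {y₀ y₁ : ℝ} (h₀ : -b.δ < y₀) (h₀' : y₀ < 2⁻¹) (h₁ : 2⁻¹ < y₁) (h₁' : y₁ < 1 + b.δ) :
    ∃ Θ : ℝ → ℝ, ContinuousOn Θ (Icc y₀ y₁) ∧ (∀ y ∈ Icc y₀ y₁, L (circlePt (Θ y)) = b.band (pt2 a y)) ∧
      (∀ y ∈ Ioo y₀ y₁, ContDiffAt ℝ ∞ Θ y) ∧
      (0 < c → StrictMonoOn Θ (Icc y₀ y₁) ∧ (∀ y ∈ Ioo y₀ y₁, 0 < deriv Θ y) ∧ Θ y₁ < Θ y₀ + 1) ∧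
      (c < 0 → StrictAntiOn Θ (Icc y₀ y₁) ∧ (∀ y ∈ Ioo y₀ y₁, deriv Θ y < 0) ∧ Θ y₀ < Θ y₁ + 1) := by
  set γ : ℝ → 𝕊 3 := fun y ↦ b.band (pt2 a y) with hγ
  have hy01 : y₀ < y₁ := by linarith
  have hsub : Icc y₀ y₁ ⊆ Ioo (-b.δ) (1 + b.δ) := fun y hy ↦ ⟨by linarith [hy.1], by linarith [hy.2]⟩
  have hsub' : Ioo y₀ y₁ ⊆ Ioo (-b.δ) (1 + b.δ) := fun y hy ↦ hsub (Ioo_subset_Icc_self hy)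
  obtain ⟨Θ, hΘc, heq, hsm, hmono⟩ := L.exists_lift_Icc (b.continuous_band_pt2 a) hy01
    (fun y hy ↦ hmem y (hsub hy))
  have hsmooth : ∀ y ∈ Ioo y₀ y₁, ContDiffAt ℝ ∞ Θ y := fun y hy ↦
    hsm y hy (b.contMDiff_band_pt2 a y)
  have hinj : InjOn γ (Ioo y₀ y₁) := (b.injOn_band_pt2 ha).mono hsub'
  have hmono' := hmono hinj
  have hhalf : (2⁻¹ : ℝ) ∈ Ioo y₀ y₁ := ⟨h₀', h₁⟩
  -- the chain rule along the lift
  have hrel : ∀ y ∈ Ioo y₀ y₁, deriv (fun t ↦ ((γ t : 𝕊 3) : 𝔼 4)) y =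
      deriv Θ y • deriv (Knot.curve L) (Θ y) := fun y hy ↦
    L.deriv_coe_eq_deriv_lift_smul (b.contMDiff_band_pt2 a y)
      (hΘc.continuousAt (Icc_mem_nhds hy.1 hy.2))
      (Filter.eventually_of_mem (Icc_mem_nhds hy.1 hy.2) fun s hs ↦ heq s hs)
  have hne : ∀ y ∈ Ioo y₀ y₁, deriv Θ y ≠ 0 := fun y hy h0 ↦ by
    have := hrel y hy
    rw [h0, zero_smul] at this
    exact b.deriv_coe_band_pt2_ne_zero (pt2_mem_squareNhd_iff.2 ⟨ha, hsub' hy⟩) this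
  -- the orientation clause pins the sign of `Θ' (1/2)`
  have hsign : deriv Θ 2⁻¹ * (2 * π * c) = 1 := by
    -- `Θ (1/2)` and `θ / 2π` are parameters of the same point of `L`
    have hθ : L (circlePt (Θ 2⁻¹)) = L (circlePt ((2 * π)⁻¹ * θ)) := by
      rw [heq _ (Ioo_subset_Icc_self hhalf), circlePt_eq_circlePoint,
        mul_inv_cancel_left₀ (by positivity : (2 * π : ℝ) ≠ 0), hpt]
    obtain ⟨m, hm⟩ := (L.apply_circlePt_eq_iff).1 hθ
    have hD : deriv (Knot.curve L) (Θ 2⁻¹) =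
        (2 * π * c) • fderiv ℝ (fun x ↦ ((b.band x : 𝕊 3) : 𝔼 4)) (pt2 a 2⁻¹) (pt2 0 1) := by
      rw [hm, L.deriv_curve_add_int]
      have h1 := L.deriv_coe_apply_circlePoint θ
      rw [hder] at h1
      -- `c • v = (2π)⁻¹ • D`, so `D = (2π c) • v`
      have h2 := congrArg (fun w : 𝔼 4 ↦ (2 * π) • w) h1
      simp only [smul_smul, mul_inv_cancel₀ (by positivity : (2 * π : ℝ) ≠ 0), one_smul] at h2
      rw [← h2]
    have h3 := hrel 2⁻¹ hhalf
    rw [hD, smul_smul, hγ, b.deriv_coe_band_pt2 a 2⁻¹] at h3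
    set v := fderiv ℝ (fun x ↦ ((b.band x : 𝕊 3) : 𝔼 4)) (pt2 a 2⁻¹) (pt2 0 1) with hv
    have hv0 : v ≠ 0 := by
      rw [hv, ← b.deriv_coe_band_pt2 a 2⁻¹]
      exact b.deriv_coe_band_pt2_ne_zero (pt2_mem_squareNhd_iff.2 ⟨ha, hsub' hhalf⟩)
    have h4 : (1 - deriv Θ 2⁻¹ * (2 * π * c)) • v = 0 := by
      rw [sub_smul, one_smul, ← h3, sub_self]
    have := (smul_eq_zero.1 h4).resolve_right hv0
    linarith
  -- no two parameters of `[y₀, y₁]` differ by a period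
  have hper : ∀ y ∈ Icc y₀ y₁, ∀ y' ∈ Icc y₀ y₁, Θ y' = Θ y + 1 → False := by
    intro y hy y' hy' h
    have : γ y' = γ y := by
      show b.band (pt2 a y') = b.band (pt2 a y)
      rw [← heq y hy, ← heq y' hy', h, L.apply_circlePt_eq_iff]
      exact ⟨1, by simp⟩
    have hyy' : y' = y := b.injOn_band_pt2 ha (hsub hy') (hsub hy) this
    rw [hyy'] at h
    linarith
  refine ⟨Θ, hΘc, heq, hsmooth, fun hcpos ↦ ?_, fun hcneg ↦ ?_⟩
  · -- `c > 0`: increasing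
    have hpos : 0 < deriv Θ 2⁻¹ := by
      by_contra hle
      have : deriv Θ 2⁻¹ * (2 * π * c) ≤ 0 :=
        mul_nonpos_of_nonpos_of_nonneg (not_lt.1 hle) (by positivity)
      linarith
    have hm : StrictMonoOn Θ (Icc y₀ y₁) := by
      rcases hmono' with h | h
      · exact h
      · exact absurd (deriv_nonpos_of_strictAntiOn (h.mono Ioo_subset_Icc_self) hhalf) (not_le.2 hpos)
    refine ⟨hm, fun y hy ↦ lt_of_le_of_ne
      (deriv_nonneg_of_strictMonoOn (hm.mono Ioo_subset_Icc_self) hy) (hne y hy).symm, ?_⟩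
    by_contra hle
    push Not at hle
    obtain ⟨y, hy, hyv⟩ : Θ y₀ + 1 ∈ Θ '' Icc y₀ y₁ :=
      intermediate_value_Icc hy01.le hΘc ⟨by linarith, hle⟩
    exact hper y₀ (left_mem_Icc.2 hy01.le) y hy hyv
  · -- `c < 0`: decreasing
    have hneg : deriv Θ 2⁻¹ < 0 := by
      by_contra hle
      have : deriv Θ 2⁻¹ * (2 * π * c) ≤ 0 :=
        mul_nonpos_of_nonneg_of_nonpos (not_lt.1 hle) (by nlinarith [Real.pi_pos])
      linarith
    have hm : StrictAntiOn Θ (Icc y₀ y₁) := by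
      rcases hmono' with h | h
      · exact absurd (deriv_nonneg_of_strictMonoOn (h.mono Ioo_subset_Icc_self) hhalf) (not_le.2 hneg)
      · exact h
    refine ⟨hm, fun y hy ↦ lt_of_le_of_ne
      (deriv_nonpos_of_strictAntiOn (hm.mono Ioo_subset_Icc_self) hy) (hne y hy), ?_⟩
    by_contra hle
    push Not at hle
    obtain ⟨y, hy, hyv⟩ : Θ y₁ + 1 ∈ Θ '' Icc y₀ y₁ :=
      intermediate_value_Icc' hy01.le hΘc ⟨by linarith, hle⟩
    exact hper y₁ (right_mem_Icc.2 hy01.le) y hy hyv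

/-- **The lift of the left edge.** For `-δ < y₀ < 1/2 < y₁ < 1 + δ` the left edge
`y ↦ band (0, y)` lifts through `K₁ ∘ circlePt` to a function `Θ`, continuous on `[y₀, y₁]` and
`C^∞` inside, **strictly increasing** with positive derivative (`orient_left`: `K₁` traverses
the left edge upwards) and window shorter than one period. [folklore] -/
theorem exists_leftLift {y₀ y₁ : ℝ} (h₀ : -b.δ < y₀) (h₀' : y₀ < 2⁻¹) (h₁ : 2⁻¹ < y₁)
    (h₁' : y₁ < 1 + b.δ) :
    ∃ Θ : ℝ → ℝ, ContinuousOn Θ (Icc y₀ y₁) ∧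
      (∀ y ∈ Icc y₀ y₁, K₁ (circlePt (Θ y)) = b.band (pt2 0 y)) ∧
      (∀ y ∈ Ioo y₀ y₁, ContDiffAt ℝ ∞ Θ y) ∧ StrictMonoOn Θ (Icc y₀ y₁) ∧
      (∀ y ∈ Ioo y₀ y₁, 0 < deriv Θ y) ∧ Θ y₁ < Θ y₀ + 1 := by
  obtain ⟨θ, c, hc, hpt, hder⟩ := b.orient_left
  have ha : (0 : ℝ) ∈ Ioo (-b.δ) (1 + b.δ) := ⟨by linarith [b.δ_pos], by linarith [b.δ_pos]⟩
  obtain ⟨Θ, hΘc, heq, hsm, hpos, -⟩ := b.exists_edgeLift ha (fun y hy ↦ b.band_pt2_zero_mem (Ioo_subset_Icc_self hy))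
    hpt hder h₀ h₀' h₁ h₁'
  obtain ⟨hm, hd, hw⟩ := hpos hc
  exact ⟨Θ, hΘc, heq, hsm, hm, hd, hw⟩

/-- **The lift of the right edge.** For `-δ < y₀ < 1/2 < y₁ < 1 + δ` the right edge
`y ↦ band (1, y)` lifts through `K₂ ∘ circlePt` to a function `Θ`, continuous on `[y₀, y₁]` and
`C^∞` inside, **strictly decreasing** with negative derivative (`orient_right`: `K₂` traverses
the right edge downwards) and window shorter than one period. [folklore] -/
theorem exists_rightLift {y₀ y₁ : ℝ} (h₀ : -b.δ < y₀) (h₀' : y₀ < 2⁻¹) (h₁ : 2⁻¹ < y₁)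
    (h₁' : y₁ < 1 + b.δ) :
    ∃ Θ : ℝ → ℝ, ContinuousOn Θ (Icc y₀ y₁) ∧
      (∀ y ∈ Icc y₀ y₁, K₂ (circlePt (Θ y)) = b.band (pt2 1 y)) ∧
      (∀ y ∈ Ioo y₀ y₁, ContDiffAt ℝ ∞ Θ y) ∧ StrictAntiOn Θ (Icc y₀ y₁) ∧
      (∀ y ∈ Ioo y₀ y₁, deriv Θ y < 0) ∧ Θ y₀ < Θ y₁ + 1 := by
  obtain ⟨θ, c, hc, hpt, hder⟩ := b.orient_right
  have ha : (1 : ℝ) ∈ Ioo (-b.δ) (1 + b.δ) := ⟨by linarith [b.δ_pos], by linarith [b.δ_pos]⟩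
  -- `c • ∂band (0, -1) = (-c) • ∂band (0, 1)`
  have hder' : deriv (fun t ↦ ((K₂ (circlePoint t) : 𝕊 3) : 𝔼 4)) θ =
      (-c) • fderiv ℝ (fun x ↦ ((b.band x : 𝕊 3) : 𝔼 4)) (pt2 1 2⁻¹) (pt2 0 1) := by
    rw [hder, neg_smul, ← smul_neg, ← map_neg]
    congr 2
    ext i
    fin_cases i <;> simp
  obtain ⟨Θ, hΘc, heq, hsm, -, hneg⟩ := b.exists_edgeLift ha (fun y hy ↦ b.band_pt2_one_mem (Ioo_subset_Icc_self hy))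
    hpt hder' h₀ h₀' h₁ h₁'
  obtain ⟨hm, hd, hw⟩ := hneg (neg_lt_zero.2 hc)
  exact ⟨Θ, hΘc, heq, hsm, hm, hd, hw⟩

end BandData

end Literature.Topology.FourManifolds
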